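import Summits.QuantumFields.QCD.Theses.PauliWegnerSea

/-!
# `ChiralGluonicCompletion` (crux stmt-QuantumFields-17498) — negative-side support: k-UNIFORM LOCAL
# LIPSCHITZ mass-regularity of the gap curve (the output shape of "mass openness", idea card
# `pointwise-suffices`) still does not entail the hereditary pin E*

Crux-triage r1 (triager 1) calibration, companion to the landed threshold model
`StronglyChiralSubsequence.pinThreshold_not_entails_hereditaryPin` (p144745, lead c5).  There the block model
`g k m = max (1/(i+1)) ((i+1) m)` has mass slopes `i + 1 → ∞` on the whole half-line, so one may object that any
CUTOFF-UNIFORM continuity of the lattice data in the renormalised mass — which is exactly what the idea card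
`pointwise-suffices` promises to manufacture ("mass openness": on every compact set of positive tuples the honest
correlators are Lipschitz in the mass uniformly in `k`, with constants allowed to blow up as the compact approaches
`m = 0`) — would exclude it and rescue the chirality transfer.  It does not.  Model: cutoffs in infinitely many
infinite blocks `i(k) = (Nat.unpair k).1`, gap curve `g k m = min 1 (max (1/(i+1)) ((i+1) m))` — block `i` is light
(value `1/(i+1)`) only on its private window `m ≤ 1/(i+1)²`, climbs with slope `i+1` on `[1/(i+1)², 1/(i+1)]` and is
saturated at `1` from `m = 1/(i+1)` on.  Consequently on every half-line `[m₀, ∞)`, `m₀ > 0`, ALL cutoffs are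
`1/m₀`-Lipschitz in the mass (blocks with `1/(i+1) ≤ m₀` are constant there, the finitely many others have slope
`i + 1 < 1/m₀`): `pinLipschitzModel_lipschitz`.  The model keeps every feature of the threshold model — monotone and
continuous in the mass, the pin's shape `∀ ε > 0, ∃ m > 0, ∃ᶠ k, g k m < ε`, every fixed positive tuple uniformly
gapped across all cutoffs — and is hereditarily pinned along NO subsequence (`pinLipschitz_not_entails_hereditaryPin`).
What the model lacks is mass-continuity uniform in `k` DOWN TO `m = 0` (its Lipschitz constant `1/m₀` blows up, as the
card itself predicts for its radii `r(c_m) → 0`); so the analytic input E* needs is a modulus of continuity of the gap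
in the quark mass that is uniform in the cutoff at the chiral point (GMOR / `ChiralTuning`-grade content), or the
eventual / Goldstone form of the pin in the hypothesis (VERDICT-c5) — not openness at positive masses.  The positive
counterpart `eventualPin_subseq_of_equicontinuous_at_zero` makes this precise: equicontinuity in the mass uniform in
the cutoff with a modulus valid down to `0⁺` (plus pin witnesses at bounded masses) DOES give an eventually — hence
hereditarily — pinned subsequence, by Bolzano–Weierstrass on the witnessing masses and a diagonal extraction.
No statement about lattice QCD is made here. [folklore]
-/

namespace Summit.QuantumFields.QCD.Theorems.ChiralGluonicCompletion.Negative

open Filter Topology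

/-- The Lipschitz block model's gap curve (axiomatised by its defining equation `hg`, no definition introduced) is
monotone in the mass at every cutoff. -/
theorem pinLipschitzModel_monotone (g : ℕ → ℝ → ℝ)
    (hg : ∀ k m, g k m = min 1 (max (1 / (((Nat.unpair k).1 : ℝ) + 1)) ((((Nat.unpair k).1 : ℝ) + 1) * m)))
    (k : ℕ) : Monotone (g k) := fun a b hab => by
  rw [hg, hg]
  exact min_le_min le_rfl (max_le_max le_rfl (mul_le_mul_of_nonneg_left hab (by positivity)))

/-- The Lipschitz block model's gap curve is continuous in the mass at every cutoff. -/
theorem pinLipschitzModel_continuous (g : ℕ → ℝ → ℝ)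
    (hg : ∀ k m, g k m = min 1 (max (1 / (((Nat.unpair k).1 : ℝ) + 1)) ((((Nat.unpair k).1 : ℝ) + 1) * m)))
    (k : ℕ) : Continuous (g k) := by
  have : g k = fun m => min 1 (max (1 / (((Nat.unpair k).1 : ℝ) + 1)) ((((Nat.unpair k).1 : ℝ) + 1) * m)) :=
    funext (hg k)
  rw [this]
  exact continuous_const.min (continuous_const.max (continuous_const.mul continuous_id))

/-- The Lipschitz block model has the pin's shape: rate `ε` is violated at the tuple `1/(i+1)²`, `1/(i+1) < ε`, at
every cutoff of block `i`. -/
theorem pinLipschitzModel_pinShape (g : ℕ → ℝ → ℝ)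
    (hg : ∀ k m, g k m = min 1 (max (1 / (((Nat.unpair k).1 : ℝ) + 1)) ((((Nat.unpair k).1 : ℝ) + 1) * m))) :
    ∀ ε > (0 : ℝ), ∃ m : ℝ, 0 < m ∧ ∃ᶠ k in atTop, g k m < ε := by
  intro ε hε
  obtain ⟨i, hi⟩ := exists_nat_one_div_lt hε
  refine ⟨1 / (((i : ℝ) + 1) ^ 2), by positivity, ?_⟩
  have hfreq : ∃ᶠ k in atTop, (Nat.unpair k).1 = i :=
    frequently_atTop.2 fun a => ⟨Nat.pair i a, Nat.right_le_pair i a, by simp [Nat.unpair_pair]⟩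
  refine hfreq.mono fun k hk => ?_
  have hval : (((i : ℝ) + 1)) * (1 / (((i : ℝ) + 1) ^ 2)) = 1 / ((i : ℝ) + 1) := by
    field_simp
  have hc1 : 1 / ((i : ℝ) + 1) ≤ 1 := by
    rw [div_le_one (by positivity)]
    linarith [(Nat.cast_nonneg i : (0 : ℝ) ≤ i)]
  rw [hg, hk, hval, max_self, min_eq_right hc1]
  exact hi

/-- In the Lipschitz block model every fixed positive tuple `m` is uniformly gapped at rate `min 1 m` across ALL
cutoffs (the C1-shape). -/
theorem pinLipschitzModel_tupleGap (g : ℕ → ℝ → ℝ)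
    (hg : ∀ k m, g k m = min 1 (max (1 / (((Nat.unpair k).1 : ℝ) + 1)) ((((Nat.unpair k).1 : ℝ) + 1) * m))) :
    ∀ m > (0 : ℝ), ∃ r : ℝ, 0 < r ∧ ∀ k, r ≤ g k m := by
  intro m hm
  refine ⟨min 1 m, lt_min one_pos hm, fun k => ?_⟩
  rw [hg]
  exact min_le_min le_rfl (le_max_of_le_right
    (le_mul_of_one_le_left hm.le (by linarith [(Nat.cast_nonneg (Nat.unpair k).1 : (0 : ℝ) ≤ _)])))

/-- **Cutoff-uniform local Lipschitz continuity in the mass.**  On every half-line `[m₀, ∞)`, `m₀ > 0`, every cutoff's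
gap curve is `1/m₀`-Lipschitz: blocks with `1/(i+1) ≤ m₀` are saturated at `1` there, the others have slope
`i + 1 < 1/m₀`.  This is the output shape of "mass openness" (k-uniform constants on compacts of `(0, ∞)`, blowing up
like `1/m₀` towards the chiral point). -/
theorem pinLipschitzModel_lipschitz (g : ℕ → ℝ → ℝ)
    (hg : ∀ k m, g k m = min 1 (max (1 / (((Nat.unpair k).1 : ℝ) + 1)) ((((Nat.unpair k).1 : ℝ) + 1) * m))) :
    ∀ m₀ > (0 : ℝ), ∀ (k : ℕ) (m m' : ℝ), m₀ ≤ m → m₀ ≤ m' → |g k m - g k m'| ≤ |m - m'| / m₀ := by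
  intro m₀ hm₀ k m m' hm hm'
  set s : ℝ := ((Nat.unpair k).1 : ℝ) + 1 with hs
  have hs0 : 0 < s := by positivity
  by_cases hcase : 1 ≤ s * m₀
  · -- saturated block: both values equal `1`
    have h1 : ∀ x, m₀ ≤ x → g k x = 1 := by
      intro x hx
      rw [hg]
      refine min_eq_left (le_max_of_le_right (hcase.trans ?_))
      exact mul_le_mul_of_nonneg_left hx hs0.le
    rw [h1 m hm, h1 m' hm', sub_self, abs_zero]
    positivity
  · -- light block: slope `s < 1/m₀`
    rw [not_le] at hcase
    have hslope : s ≤ 1 / m₀ := by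
      rw [le_div_iff₀ hm₀]
      exact hcase.le
    have hstep : |g k m - g k m'| ≤ |s * m - s * m'| := by
      rw [hg, hg]
      refine (abs_min_sub_min_le_max _ _ _ _).trans ?_
      rw [sub_self, abs_zero]
      refine max_le (abs_nonneg _) ?_
      refine (abs_max_sub_max_le_max _ _ _ _).trans ?_
      rw [sub_self, abs_zero]
      exact max_le (abs_nonneg _) le_rfl
    calc |g k m - g k m'| ≤ |s * m - s * m'| := hstep
      _ = s * |m - m'| := by rw [← mul_sub, abs_mul, abs_of_pos hs0]
      _ ≤ (1 / m₀) * |m - m'| := mul_le_mul_of_nonneg_right hslope (abs_nonneg _)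
      _ = |m - m'| / m₀ := by ring

/-- The Lipschitz block model is hereditarily pinned along NO subsequence: every strictly increasing `φ` has a
strictly increasing `ψ` and a rate `ε > 0` at which every positive tuple is eventually NOT violated along `φ ∘ ψ`
(a block met infinitely often is never lighter than its floor `1/(i₀+1)`; a subsequence leaving every block has
every fixed tuple eventually saturated at `1`). -/
theorem pinLipschitzModel_not_hereditary (g : ℕ → ℝ → ℝ)
    (hg : ∀ k m, g k m = min 1 (max (1 / (((Nat.unpair k).1 : ℝ) + 1)) ((((Nat.unpair k).1 : ℝ) + 1) * m)))
    (φ : ℕ → ℕ) (_hφ : StrictMono φ) :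
    ∃ ψ : ℕ → ℕ, StrictMono ψ ∧ ∃ ε > (0 : ℝ), ∀ m : ℝ, 0 < m → ∀ᶠ k in atTop, ¬ g (φ (ψ k)) m < ε := by
  by_cases h : ∃ i₀ : ℕ, ∃ᶠ k in atTop, (Nat.unpair (φ k)).1 = i₀
  · obtain ⟨i₀, hi₀⟩ := h
    obtain ⟨ψ, hψ, hψi⟩ := extraction_of_frequently_atTop hi₀
    have hc1 : 1 / ((i₀ : ℝ) + 1) ≤ 1 := by
      rw [div_le_one (by positivity)]
      linarith [(Nat.cast_nonneg i₀ : (0 : ℝ) ≤ i₀)]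
    refine ⟨ψ, hψ, 1 / ((i₀ : ℝ) + 1), Nat.one_div_pos_of_nat, fun m _ => Eventually.of_forall fun k => ?_⟩
    rw [hg, hψi k, not_lt]
    exact le_min hc1 (le_max_left _ _)
  · simp only [not_exists, not_frequently] at h
    refine ⟨id, strictMono_id, 1, one_pos, fun m hm => ?_⟩
    obtain ⟨N, hN⟩ := exists_nat_ge (1 / m)
    have hall : ∀ᶠ k in atTop, ∀ i ∈ Finset.range N, ¬ (Nat.unpair (φ k)).1 = i :=
      (eventually_all_finset (Finset.range N)).2 fun i _ => h i
    refine hall.mono fun k hk => ?_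
    have hkN : N ≤ (Nat.unpair (φ k)).1 := by
      by_contra hlt
      exact hk _ (Finset.mem_range.2 (not_le.1 hlt)) rfl
    have hNm : (1 : ℝ) ≤ (N : ℝ) * m := by rwa [div_le_iff₀ hm] at hN
    have hmono : (N : ℝ) * m ≤ (((Nat.unpair (φ (id k))).1 : ℝ) + 1) * m := by
      refine mul_le_mul_of_nonneg_right ?_ hm.le
      have : (N : ℝ) ≤ ((Nat.unpair (φ k)).1 : ℝ) := by exact_mod_cast hkN
      simpa using by linarith
    rw [hg, not_lt]
    exact le_min le_rfl (le_max_of_le_right (hNm.trans hmono))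

/-- **Cutoff-uniform local Lipschitz mass-regularity does not entail the hereditary pin E*.**  There is a gap curve
`g : ℕ → ℝ → ℝ` (cutoff, mass), MONOTONE and CONTINUOUS in the mass at every cutoff, with the pin's shape
`∀ ε > 0, ∃ m > 0, ∃ᶠ k, g k m < ε`, every fixed positive tuple uniformly gapped across all cutoffs, AND uniformly
`1/m₀`-Lipschitz in the mass on every `[m₀, ∞)` across ALL cutoffs, such that NO subsequence `φ` is hereditarily
pinned.  Witness: `g k m = min 1 (max (1/(i+1)) ((i+1) m))`, `i = (Nat.unpair k).1`.  Reading (crux-triage r1):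
the `MassLocalLipschitz`/`PointwiseSuffices` output of idea `pointwise-suffices` — k-uniform mass-equicontinuity on
compacts of positive tuples — cannot certify a strongly chiral subsequence for a general hypothesis witness; only
equicontinuity reaching `m = 0` (or the eventual/Goldstone pin) can. [folklore] -/
theorem pinLipschitz_not_entails_hereditaryPin :
    ∃ g : ℕ → ℝ → ℝ,
      (∀ k, Monotone (g k)) ∧ (∀ k, Continuous (g k)) ∧
      (∀ ε > (0 : ℝ), ∃ m : ℝ, 0 < m ∧ ∃ᶠ k in atTop, g k m < ε) ∧
      (∀ m > (0 : ℝ), ∃ r : ℝ, 0 < r ∧ ∀ k, r ≤ g k m) ∧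
      (∀ m₀ > (0 : ℝ), ∀ (k : ℕ) (m m' : ℝ), m₀ ≤ m → m₀ ≤ m' → |g k m - g k m'| ≤ |m - m'| / m₀) ∧
      ¬ ∃ φ : ℕ → ℕ, StrictMono φ ∧ ∀ ψ : ℕ → ℕ, StrictMono ψ →
          ∀ ε > (0 : ℝ), ∃ m : ℝ, 0 < m ∧ ∃ᶠ k in atTop, g (φ (ψ k)) m < ε := by
  refine ⟨fun k m => min 1 (max (1 / (((Nat.unpair k).1 : ℝ) + 1)) ((((Nat.unpair k).1 : ℝ) + 1) * m)),
    pinLipschitzModel_monotone _ fun _ _ => rfl, pinLipschitzModel_continuous _ fun _ _ => rfl,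
    pinLipschitzModel_pinShape _ fun _ _ => rfl, pinLipschitzModel_tupleGap _ fun _ _ => rfl,
    pinLipschitzModel_lipschitz _ fun _ _ => rfl, ?_⟩
  rintro ⟨φ, hφ, hher⟩
  obtain ⟨ψ, hψ, ε, hε, hnot⟩ := pinLipschitzModel_not_hereditary _ (fun _ _ => rfl) φ hφ
  obtain ⟨m, hm, hfreq⟩ := hher ψ hψ ε hε
  obtain ⟨k, hk₁, hk₂⟩ := ((hnot m hm).and_frequently hfreq).exists
  exact hk₁ hk₂

/-- **What would suffice instead: mass-equicontinuity uniform in the cutoff DOWN TO the chiral point.**  If the gap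
curves `g k` are equicontinuous on the positive masses uniformly in `k` with a modulus valid down to `m = 0⁺` (any
modulus — Hölder `√m` as in GMOR is allowed, Lipschitz is not needed), and the pin is witnessed at bounded masses,
then some subsequence is EVENTUALLY pinned (hence hereditarily, `eventualShape_hereditary`): diagonalise over the
levels, extract a convergent subsequence of the witnessing masses (limit `L ≥ 0`), and transport each level's
violation to the fixed mass `L` (if `L > 0`) or to a fixed small mass (if `L = 0`) by the uniform modulus.  Contrast
`pinLipschitz_not_entails_hereditaryPin`: constants blowing up at `0` are exactly what breaks the transfer. [folklore] -/
theorem eventualPin_subseq_of_equicontinuous_at_zero (g : ℕ → ℝ → ℝ) (B : ℝ)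
    (hω : ∀ η > (0 : ℝ), ∃ δ > (0 : ℝ), ∀ (k : ℕ) (m m' : ℝ), 0 < m → 0 < m' → |m - m'| < δ →
      |g k m - g k m'| < η)
    (hpin : ∀ ε > (0 : ℝ), ∃ m : ℝ, 0 < m ∧ m ≤ B ∧ ∃ᶠ k in atTop, g k m < ε) :
    ∃ φ : ℕ → ℕ, StrictMono φ ∧ ∀ ε > (0 : ℝ), ∃ m : ℝ, 0 < m ∧ ∀ᶠ n in atTop, g (φ n) m < ε := by
  -- witnessing masses, level `j` = rate `1/(j+1)`
  choose mj hmj_pos hmj_le hmj_freq using fun j : ℕ => hpin (1 / ((j : ℝ) + 1)) Nat.one_div_pos_of_nat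
  -- Bolzano–Weierstrass on the masses
  have hbdd : Bornology.IsBounded (Set.Icc (0 : ℝ) B) := Metric.isBounded_Icc 0 B
  obtain ⟨L, -, θ, hθ, hconv⟩ :=
    tendsto_subseq_of_bounded hbdd (x := mj) fun j => ⟨(hmj_pos j).le, hmj_le j⟩
  -- diagonal extraction through the violation sets of the levels `θ n`
  obtain ⟨φ, hφ, hviol⟩ := extraction_forall_of_frequently (P := fun n k => g k (mj (θ n)) < 1 / ((θ n : ℝ) + 1))
    fun n => hmj_freq (θ n)
  refine ⟨φ, hφ, fun ε hε => ?_⟩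
  obtain ⟨δ, hδ, hωδ⟩ := hω (ε / 2) (half_pos hε)
  -- the level rates along `θ` are eventually below `ε/2`
  have hrate : ∀ᶠ n in atTop, 1 / ((θ n : ℝ) + 1) < ε / 2 := by
    obtain ⟨N, hN⟩ := exists_nat_one_div_lt (half_pos hε)
    refine eventually_atTop.2 ⟨N, fun n hn => lt_of_le_of_lt ?_ hN⟩
    have hNθ : (N : ℝ) + 1 ≤ (θ n : ℝ) + 1 := by
      have : N ≤ θ n := hn.trans (hθ.id_le n)
      exact_mod_cast Nat.succ_le_succ this
    exact one_div_le_one_div_of_le (by positivity) hNθ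
  -- the witnessing masses along `θ` are eventually `δ/2`-close to `L`
  have hclose : ∀ᶠ n in atTop, |mj (θ n) - L| < δ / 2 := by
    have := (Metric.tendsto_atTop.1 hconv) (δ / 2) (half_pos hδ)
    obtain ⟨N, hN⟩ := this
    exact eventually_atTop.2 ⟨N, fun n hn => by simpa [Real.dist_eq] using hN n hn⟩
  by_cases hL : 0 < L
  · refine ⟨L, hL, ?_⟩
    filter_upwards [hrate, hclose] with n hn hc
    have hmod : |g (φ n) (mj (θ n)) - g (φ n) L| < ε / 2 :=
      hωδ (φ n) (mj (θ n)) L (hmj_pos _) hL (by linarith [abs_sub_lt_iff.1 hc])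
    have hv : g (φ n) (mj (θ n)) < 1 / ((θ n : ℝ) + 1) := hviol n
    have := abs_sub_lt_iff.1 hmod
    linarith [this.1, this.2]
  · rw [not_lt] at hL
    refine ⟨δ / 2, half_pos hδ, ?_⟩
    filter_upwards [hrate, hclose] with n hn hc
    have hm_small : mj (θ n) < δ / 2 := by
      have := (abs_sub_lt_iff.1 hc).1
      linarith
    have hdist : |mj (θ n) - δ / 2| < δ := by
      rw [abs_sub_lt_iff]
      constructor <;> linarith [hmj_pos (θ n)]
    have hmod : |g (φ n) (mj (θ n)) - g (φ n) (δ / 2)| < ε / 2 :=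
      hωδ (φ n) (mj (θ n)) (δ / 2) (hmj_pos _) (half_pos hδ) hdist
    have hv : g (φ n) (mj (θ n)) < 1 / ((θ n : ℝ) + 1) := hviol n
    have := abs_sub_lt_iff.1 hmod
    linarith [this.1, this.2]

end Summit.QuantumFields.QCD.Theorems.ChiralGluonicCompletion.Negative
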